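import Summits.QuantumFields.BalabanUV.T4Continuum.Support.GramPerturbationLaw
import Summits.QuantumFields.BalabanUV.T4Continuum.Spine.NE2ColourPerturbedLayer

/-!
# T⁴ programme, spine node NE2 (U1a) — THE COVARIANT-AVERAGING SUMMAND `a·(Q_k(U)ᴴQ_k(U) − Q_kᴴQ_k)` ON THE COLOUR LAYER:
# `PerturbationLaws` from the size and the two-level consistency of the SITE TRANSPORTS (tier B, row B3.b-inst of
# `t4/formal/NE2/LEAVES.md` = skeleton `t4/SKELETON-NE2-P1.md` §2B row B3, the instance of the owner's `Support/GramPerturbationLaw`)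

NE2 formalisation swarm `b2b-balaban-t4-ne2-formalise-*`, leaf 01, file 1.  The row owner's `Support/GramPerturbationLaw` (p207658)
reduced the third summand of Bałaban's background operator — [Balaban1985BackgroundPropagators] (3.26) p.395 «or simply
Δ_a = Δ + DRD* + Q*aQ. It coincides with Δ_a in (2.19) if U = 1» — to NORM DATA: for an inner averaging `B` and a transport error `E`
with sandwiched two-level pairings, `PerturbationLaws D (a·((B + E)ᴴ(B + E) − BᴴB)) J κ e₂` (`perturbationLaws_gramCore`), and, for the
TRANSPORTED shape `E_k = B_k·(T_k − 1)` over an exactly paired free tower, `perturbationLaws_transportedGram` from `TransportLaws T J α′ βs`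
(`‖T_k − 1‖ ≤ α′`, `‖(T_{k+1} − 1)J_k − J_k(T_k − 1)‖ ≤ βs k`).  Its §4 instance is stated on the COLOURLESS King tower (`calDalev`, `JpcT`).
Tier B lives on `(sites × components) × colours`; THIS FILE supplies the colour instances and the site-transport instance:

 * §1 Kronecker bookkeeping: `Atow (Q ⊗ 1) = Atow Q ⊗ 1` (**`Atow_kron`**), `Btow (Q ⊗ 1) = Btow Q ⊗ 1` (`‖(Δ_a^{(k)} ⊗ 1)⁻¹‖ ≤ Cst` is
   `NE2ColourPerturbedLayer.opNorm_inv_calDalev_kron_le`, p207727, imported BY NAME), and the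
   DICTIONARY **`gramCore_Btow_Etrans`**: `(B + E)ᴴ(B + E) − BᴴB = r^k·((A_kT_k)ᴴ(A_kT_k) − A_kᴴA_k)` for `B = √(r^k)·A_k`, `E = B·(T − 1)` — i.e.
   the Gram core IS `n^d·(Q_k(U)ᴴQ_k(U) − Q_kᴴQ_k)` for the transported averaging `Q_k(U) = A_k·T_k` (the normalisation `Q* = n^d·Qᴴ` of
   `B5DeltaA169.QvAdj`);
 * §2 **`perturbationLaws_transportedGram_kron`**: for ANY operator family `T_k` on `idx L M k × o` with
   `TransportLaws T (JpcT ⊗ 1) α′ (Cβ·L^{−k})`, the typed target shape of the swarm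
   `PerturbationLaws (k ↦ calDalev k ⊗ₖ 1) (gramPert c (Btow (Qlev ⊗ 1) L^d) (Etrans (Qlev ⊗ 1) L^d T)) (k ↦ JpcT k ⊗ₖ 1) (kappaQ d a c α′)
   (k ↦ C2Q d a c α′ Cβ·L^{−k})`, `kappaQ = ‖c‖·α′(2 + α′)·Cst`, `C2Q = ‖c‖·C2gram Cst 1 α′ (2dCst) CJ 0 (Cst·Cβ)` — from the owner's law over
   `KroneckerLift.freeTowerLaws_kron o (NE2PerturbedLayer.freeTowerLaws_king …)` (pairing defect `0 ⊗ 1 = 0` exactly);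
 * §3 THE SITE-TRANSPORT INSTANCE — the shape of [Balaban1985BackgroundPropagators] (3.19) p.393 «(Q′(V)λ)(y) = Σ_{x∈B(y)} L^{−d}R(V(Γ_{y,x}))λ(x)»
   carried componentwise: `T_k = siteMul T̂_k` for colour matrices `T̂_k(x) ∈ M_o(ℂ)` at the fine sites (the transport from `x` to the
   reference point of its block — DATA), the hypothesis STRUCTURE on data **`SiteTransportLaws L M o T̂ α′ β′`** (`‖T̂_k(x) − 1‖ ≤ α′`;
   two-level consistency at the block parent `‖T̂_{k+1}(x′) − T̂_k(parT x′)‖ ≤ β′·L^{−k}` — the currency of node NE3 (U1b) BY NAME via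
   `Support/NE2FromNE3`, for Bałaban's nested contours the deliverable of row B3.b-conc), the EXACT intertwining
   `(siteMul T̂′ − 1)(J ⊗ 1) − (J ⊗ 1)(siteMul T̂ − 1) = siteMul(T̂′ − T̂ ∘ parT)·(J ⊗ 1)` (`BlockMultiplication.kronJK_mul_siteMul`) whence
   **`transportLaws_siteMul`**, the typed covariant averaging **`covAvg T̂ k = (Atow Qlev k ⊗ 1)·siteMul T̂_k`**, its perturbation
   **`covAvgPert T̂ c k = c·(L^d)^k·((covAvg)ᴴcovAvg − (Atow Qlev k ⊗ 1)ᴴ(Atow Qlev k ⊗ 1))`** (`covAvgPert_eq`; `= 0` at `T̂ = 1` BY CONSTRUCTION,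
   `covAvgPert_one`), and the END THEOREM **`perturbationLaws_covariantAveraging`** (`kappaQ`, `C2Q d a c α′ β′`);
 * §4 the η-RATE: **`towerLimitRate_covariantAveraging`** (every `‖t‖·kappaQ < 1`) and the physical value `c = a`, `t = 1` with the DISPLAYED
   small-field threshold `a·α′(2 + α′)·Cst(d,a) < 1` (**`covariantAveraging_rate`**).

HONEST FRAMING (T4-DAG p. 1).  MODEL LEVEL: King's plain block means `⊗ 1` with colour transport as DATA (the (3.19) scalar-averaging shape,
componentwise); NOT Bałaban's line-averaged vector averaging `Q(U)` of [Balaban1985Averaging] (124) (the `Q` inside `Δ_a` carries the line factor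
of [Balaban1984PropagatorsI] (1.61); the owner's honest note: its covariant version is not literally `Btow·(T − 1)`), NOT the dictionary B0,
GLOBAL small field, no local regions, no position-space decay; finite torus, linear layer, operator norm; rates / pairings / constants OURS;
nothing printed is a hypothesis; no `def … : Prop` fact; NE2 NOT proved; spine 0/9 unchanged; NOT infinite volume / mass gap / Clay /
summit progress.  HONEST DEPENDENCY: continuum YM on T⁴ ⇐ BetaPertH ∧ nine spine estimates (0/9 proved); BetaPertH ⇐ (D1) ∧ (D4) ∧ CAP+tail;
G-an2-4 gates asym, D1 and NE2/3/4.  ABSOLUTE RULE kept; no `sorry`.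
-/

noncomputable section

open scoped BigOperators ComplexConjugate Matrix Matrix.Norms.L2Operator Kronecker
open Filter Topology

namespace Summit.QuantumFields.BalabanUV.T4Continuum.CovariantAveragingSummand

open Literature.MathematicalPhysics.QuantumFieldTheory.Balaban1983to89.B5Prop11Plancherel (Cst Cst_nonneg)
open Literature.MathematicalPhysics.QuantumFieldTheory.Balaban1983to89.B5G183RateUnitTower (lev lev_neZero)
open Summit.QuantumFields.BalabanUV.T4Continuum
open Summit.QuantumFields.BalabanUV.T4Continuum.CovariantAveragingTower (Atow Atow_succ Atow_zero TowerLimitRate opNorm_Atow_sq_le)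
open Summit.QuantumFields.BalabanUV.T4Continuum.BalabanAveragedTowerUnit (idx Qlev opNorm_Qlev_sq_le)
open Summit.QuantumFields.BalabanUV.T4Continuum.BackgroundResolventTower
open Summit.QuantumFields.BalabanUV.T4Continuum.KingPairingPlantedLaw
open Summit.QuantumFields.BalabanUV.T4Continuum.NE2PerturbedLayer
open Summit.QuantumFields.BalabanUV.T4Continuum.PerturbationAlgebra
open Summit.QuantumFields.BalabanUV.T4Continuum.KroneckerLift
open Summit.QuantumFields.BalabanUV.T4Continuum.BlockMultiplication
open Summit.QuantumFields.BalabanUV.T4Continuum.BlockPairingGeometry (parT)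
open Summit.QuantumFields.BalabanUV.T4Continuum.GramPerturbationLaw
open Summit.QuantumFields.BalabanUV.T4Continuum.NE2ColourPerturbedLayer (opNorm_inv_calDalev_kron_le)

/-! ## §1 Kronecker bookkeeping and the Gram dictionary -/

section Generic

variable {ι : ℕ → Type*} [∀ k, Fintype (ι k)] [∀ k, DecidableEq (ι k)] (o : Type*) [Fintype o] [DecidableEq o]

/-- the composite averaging of the lifted one-step averagings is the lifted composite: `Atow (A ⊗ 1) k = Atow A k ⊗ 1`. [folklore] -/
theorem Atow_kron (A : (k : ℕ) → Matrix (ι k) (ι (k + 1)) ℂ) (k : ℕ) :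
    Atow (fun k => A k ⊗ₖ (1 : Matrix o o ℂ)) k = Atow A k ⊗ₖ (1 : Matrix o o ℂ) := by
  induction k with
  | zero => simp only [Atow_zero, Matrix.one_kronecker_one]
  | succ k ih => simp only [Atow_succ, ih, kron_mul]

/-- the normalised composite lifts likewise: `Btow (A ⊗ 1) r k = Btow A r k ⊗ 1`. [folklore] -/
theorem Btow_kron (A : (k : ℕ) → Matrix (ι k) (ι (k + 1)) ℂ) (r : ℝ) (k : ℕ) :
    Btow (fun k => A k ⊗ₖ (1 : Matrix o o ℂ)) r k = Btow A r k ⊗ₖ (1 : Matrix o o ℂ) := by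
  rw [Btow, Btow, Atow_kron, ← Matrix.smul_kronecker]

/-- **THE GRAM DICTIONARY**: for `B_k = √(r^k)·A_k` and the transported error `E_k = B_k·(T_k − 1)`,
`(B_k + E_k)ᴴ(B_k + E_k) − B_kᴴB_k = r^k·((A_kT_k)ᴴ(A_kT_k) − A_kᴴA_k)` — the Gram core of the owner's law IS the difference of the
averaging squares `n^d·(Q_k(U)ᴴQ_k(U) − Q_kᴴQ_k)` for the transported averaging `Q_k(U) = A_k·T_k` in the normalisation `Q* = n^d·Qᴴ`.
[folklore] -/
theorem gramCore_Btow_Etrans (A : (k : ℕ) → Matrix (ι k) (ι (k + 1)) ℂ) {r : ℝ} (hr : 0 ≤ r)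
    (T : (k : ℕ) → Matrix (ι k) (ι k) ℂ) (k : ℕ) :
    gramCore (Btow A r) (Etrans A r T) k = ((r : ℂ) ^ k) • ((Atow A k * T k)ᴴ * (Atow A k * T k) - (Atow A k)ᴴ * Atow A k) := by
  have hs : star (((Real.sqrt (r ^ k) : ℝ) : ℂ)) = ((Real.sqrt (r ^ k) : ℝ) : ℂ) := Complex.conj_ofReal _
  have hss : (((Real.sqrt (r ^ k) : ℝ) : ℂ)) * ((Real.sqrt (r ^ k) : ℝ) : ℂ) = (r : ℂ) ^ k := by
    rw [← Complex.ofReal_mul, Real.mul_self_sqrt (pow_nonneg hr k)]; push_cast; rfl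
  have e1 : Btow A r k + Etrans A r T k = (((Real.sqrt (r ^ k) : ℝ) : ℂ)) • (Atow A k * T k) := by
    rw [Etrans, Matrix.mul_sub, Matrix.mul_one, add_sub_cancel, Btow, Matrix.smul_mul]
  rw [gramCore, e1, Btow]
  simp only [Matrix.conjTranspose_smul, hs, Matrix.smul_mul, Matrix.mul_smul, smul_smul, hss, smul_sub]

end Generic

/-! ## §2 The colour-lifted King instance of the transported Gram law -/

section Tower

variable {d : ℕ} (L : ℕ) [NeZero L] (M : Fin d → ℕ) [hM : ∀ μ, NeZero (M μ)] (a : ℝ) (ha : 0 < a)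
variable (o : Type*) [Fintype o] [DecidableEq o]

/-- the relative-boundedness constant of the covariant-averaging summand: `κ_Q = ‖c‖·α′(2 + α′)·Cst` (`c = a` physically). [folklore] -/
def kappaQ (d : ℕ) (a : ℝ) (c : ℂ) (α' : ℝ) : ℝ := ‖c‖ * (α' * (2 + α') * Cst d a)

/-- its consistency constant: `C₂^Q = ‖c‖·C2gram Cst 1 α′ (2dCst) CJ 0 (Cst·Cβ)` (linear in the transport-consistency constant `Cβ` and in
the free defects; OURS). [folklore] -/
def C2Q (d : ℕ) (a : ℝ) (c : ℂ) (α' Cβ : ℝ) : ℝ :=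
  ‖c‖ * C2gram (Cst d a) 1 α' (2 * d * Cst d a) (CJ d a) 0 (Cst d a * Cβ)

/-- at the physical coupling `c = a ≥ 0`: `κ_Q = a·α′(2 + α′)·Cst(d,a)` — the small-field threshold is `κ_Q < 1`, DISPLAYED. [folklore] -/
theorem kappaQ_ofReal {d : ℕ} {a : ℝ} (ha' : 0 ≤ a) (α' : ℝ) : kappaQ d a (a : ℂ) α' = a * (α' * (2 + α') * Cst d a) := by
  rw [kappaQ, Complex.norm_real, Real.norm_of_nonneg ha']

/-- **THE TRANSPORTED GRAM LAW ON THE COLOUR LAYER** (the swarm's ONE TARGET SHAPE): for ANY transport operator family `T_k` on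
`idx L M k × o` with `‖T_k − 1‖ ≤ α′` and `‖(T_{k+1} − 1)(J_k ⊗ 1) − (J_k ⊗ 1)(T_k − 1)‖ ≤ Cβ·L^{−k}`,
`PerturbationLaws (Δ_a ⊗ 1) (c·((B + E)ᴴ(B + E) − BᴴB)) (J ⊗ 1) κ_Q (C₂^Q·L^{−k})` with `B_k = √((L^d)^k)·(Atow Qlev k ⊗ 1)` (King's isometrically
normalised `k`-fold block mean, lifted) and `E_k = B_k(T_k − 1)`.  Proof: the owner's `perturbationLaws_transportedGram` over
`freeTowerLaws_kron o (freeTowerLaws_king …)` (pairing defect `0 ⊗ 1 = 0` exactly, `γ′ = Cst`), scaled by `c` and put in geometric form.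
[cite: King1986, (2.10) p.653, p.664; Balaban1984PropagatorsI, Prop. 1.1 (1.89) p.33; Balaban1985BackgroundPropagators, (3.26) p.395 (where `Q*(U)aQ(U)`
enters)] [folklore] -/
theorem perturbationLaws_transportedGram_kron {T : (k : ℕ) → Matrix (idx L M k × o) (idx L M k × o) ℂ} {α' Cβ : ℝ} (hα : 0 ≤ α')
    (hT : TransportLaws T (fun k => JpcT L M k ⊗ₖ (1 : Matrix o o ℂ)) α' (fun k => Cβ * ((L : ℝ)⁻¹) ^ k)) (c : ℂ) :
    PerturbationLaws (fun k => calDalev L M a ha k ⊗ₖ (1 : Matrix o o ℂ))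
      (gramPert c (Btow (fun k => Qlev L M k ⊗ₖ (1 : Matrix o o ℂ)) ((L : ℝ) ^ d))
        (Etrans (fun k => Qlev L M k ⊗ₖ (1 : Matrix o o ℂ)) ((L : ℝ) ^ d) T))
      (fun k => JpcT L M k ⊗ₖ (1 : Matrix o o ℂ)) (kappaQ d a c α') (fun k => C2Q d a c α' Cβ * ((L : ℝ)⁻¹) ^ k) := by
  have hr : (0 : ℝ) < (L : ℝ) ^ d := pow_pos (by exact_mod_cast Nat.pos_of_ne_zero (NeZero.ne L)) d
  have h := perturbationLaws_smul c (perturbationLaws_transportedGram hr (freeTowerLaws_kron o (freeTowerLaws_king L M a ha))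
    (fun k => Matrix.zero_kronecker _) (opNorm_inv_calDalev_kron_le L M a ha) hT)
  refine perturbationLaws_mono h (le_of_eq ?_) fun k => ?_
  · rw [kappaQ]; ring
  · refine (mul_le_mul_of_nonneg_left (e2gram_le_geom (ρ := (L : ℝ)⁻¹) (C₀ := 2 * d * Cst d a) (C₁ := CJ d a) (Cf := 0)
      (Cδ := Cst d a * Cβ) (Cst_nonneg d a) zero_le_one hα (fun k => le_rfl) (fun k => le_rfl)
      (fun k => le_of_eq (zero_mul _).symm) (fun k => le_of_eq (mul_assoc _ _ _).symm) k) (norm_nonneg c)).trans (le_of_eq ?_)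
    rw [C2Q]; ring

/-- **… AND ITS η-RATE** (`L ≥ 2`, every coupling `‖t‖·κ_Q < 1`): the lifted King-averaged unit-lattice covariances of
`(Δ_a^{(k)} ⊗ 1 + t·c·((B + E)ᴴ(B + E) − BᴴB)_k)⁻¹` CONVERGE with rate `L^{−k}`, `‖c_k(t) − c_∞(t)‖ ≤ Cpert(t)·L^{−k}/(1 − L^{−1})`, all orders in `t`.
[cite: King1986, Lemma 4.5 (4.32)/(4.38) p.674 (scalar template)] [folklore] -/
theorem towerLimitRate_transportedGram_kron (hL : 2 ≤ L) {T : (k : ℕ) → Matrix (idx L M k × o) (idx L M k × o) ℂ} {α' Cβ : ℝ}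
    (hα : 0 ≤ α') (hT : TransportLaws T (fun k => JpcT L M k ⊗ₖ (1 : Matrix o o ℂ)) α' (fun k => Cβ * ((L : ℝ)⁻¹) ^ k)) (c : ℂ)
    {t : ℂ} (ht : ‖t‖ * kappaQ d a c α' < 1) :
    TowerLimitRate (fun k => Qlev L M k ⊗ₖ (1 : Matrix o o ℂ)) ((L : ℝ) ^ d)
      (fun k => (calDalev L M a ha k ⊗ₖ (1 : Matrix o o ℂ)
        + t • gramPert c (Btow (fun k => Qlev L M k ⊗ₖ (1 : Matrix o o ℂ)) ((L : ℝ) ^ d))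
            (Etrans (fun k => Qlev L M k ⊗ₖ (1 : Matrix o o ℂ)) ((L : ℝ) ^ d) T) k)⁻¹)
      (Cpert (kappaQ d a c α') (2 * d * Cst d a) (CJ d a) (C2Q d a c α' Cβ) 0 t) ((L : ℝ)⁻¹) := by
  have hL1 : (1 : ℝ) < L := by exact_mod_cast (lt_of_lt_of_le one_lt_two hL : 1 < L)
  have hr : (0 : ℝ) < (L : ℝ) ^ d := pow_pos (lt_trans zero_lt_one hL1) d
  refine towerLimitRate_perturbed hr (freeTowerLaws_kron o (freeTowerLaws_king L M a ha))
    (perturbationLaws_transportedGram_kron L M a ha o hα hT c) (inv_lt_one_of_one_lt₀ hL1)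
    (fun k => le_rfl) (fun k => le_rfl) (fun k => le_rfl) (fun k => ?_) ht
  simp only [zero_mul, le_refl]

/-! ## §3 The site-transport instance: covariant block averaging of the (3.19) shape -/

/-- **THE LAWS OF A SITE-TRANSPORT FIELD** `T̂_k(x) ∈ M_o(ℂ)` (the colour transport from the fine site `x` of the lattice `L^{−k}` to
the reference point of its block — DATA; for a background tower `U_k` these are the adjoint transporters `R(U_k(Γ_{y,x}))` along
Bałaban's block contours): SIZE `‖T̂_k(x) − 1‖ ≤ α′` (small field) and TWO-LEVEL CONSISTENCY at the block parent
`‖T̂_{k+1}(x′) − T̂_k(parT x′)‖ ≤ β′·L^{−k}` (`= β′/n_k`; the currency of node NE3 (U1b) by name via `Support/NE2FromNE3` — for the nested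
contours the deliverable of row B3.b-conc).  A hypothesis STRUCTURE on data, asserted by nobody. [cite: Balaban1985BackgroundPropagators,
(3.19) p.393 (shape of the transported block average)] [folklore] -/
structure SiteTransportLaws (T : (k : ℕ) → idx L M k → Matrix o o ℂ) (α' β' : ℝ) : Prop where
  /-- `α′, β′ ≥ 0` -/
  nonneg : 0 ≤ α' ∧ 0 ≤ β'
  /-- small field: every transport is within `α′` of the identity -/
  sub_one_le : ∀ k x, ‖T k x - 1‖ ≤ α'
  /-- two-level consistency at the block parent -/
  consistent : ∀ k (x : idx L M (k + 1)), ‖T (k + 1) x - T k (parT (lev L k) L M x)‖ ≤ β' * ((L : ℝ)⁻¹) ^ k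

/-- **SITE TRANSPORTS SATISFY THE OWNER's `TransportLaws`** against the lifted King pairing, with `βs k = β′·L^{−k}` — by the EXACT
intertwining `(siteMul T̂′ − 1)(J ⊗ 1) − (J ⊗ 1)(siteMul T̂ − 1) = siteMul (T̂′ − T̂ ∘ parT)·(J ⊗ 1)` (`kronJK_mul_siteMul`). [cite: King1986, (2.10) p.653]
[folklore] -/
theorem transportLaws_siteMul {T : (k : ℕ) → idx L M k → Matrix o o ℂ} {α' β' : ℝ} (hT : SiteTransportLaws L M o T α' β') :
    TransportLaws (fun k => siteMul (T k)) (fun k => JpcT L M k ⊗ₖ (1 : Matrix o o ℂ)) α' (fun k => β' * ((L : ℝ)⁻¹) ^ k) where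
  sub_one_le := fun k => by
    have e : siteMul (T k) - (1 : Matrix (idx L M k × o) (idx L M k × o) ℂ) = siteMul (fun x => T k x - 1) := by
      rw [siteMul_sub, siteMul_one]
    rw [e]; exact opNorm_siteMul_le _ hT.nonneg.1 (hT.sub_one_le k)
  intertwine_le := fun k => by
    have hβk : 0 ≤ β' * ((L : ℝ)⁻¹) ^ k := mul_nonneg hT.nonneg.2 (pow_nonneg (inv_nonneg.mpr (Nat.cast_nonneg L)) k)
    have hJ : JpcT L M k ⊗ₖ (1 : Matrix o o ℂ) * siteMul (T k)
        = siteMul (fun x : idx L M (k + 1) => T k (parT (lev L k) L M x)) * JpcT L M k ⊗ₖ (1 : Matrix o o ℂ) :=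
      kronJK_mul_siteMul (lev L k) L M (T k)
    have e : (siteMul (T (k + 1)) - 1) * (JpcT L M k ⊗ₖ (1 : Matrix o o ℂ)) - JpcT L M k ⊗ₖ (1 : Matrix o o ℂ) * (siteMul (T k) - 1)
        = siteMul (fun x => T (k + 1) x - T k (parT (lev L k) L M x)) * (JpcT L M k ⊗ₖ (1 : Matrix o o ℂ)) := by
      rw [Matrix.sub_mul, Matrix.one_mul, Matrix.mul_sub, Matrix.mul_one, hJ, sub_sub_sub_cancel_right, ← Matrix.sub_mul,
        ← siteMul_sub]
    rw [e]
    calc _ ≤ ‖siteMul (fun x => T (k + 1) x - T k (parT (lev L k) L M x))‖ * ‖JpcT L M k ⊗ₖ (1 : Matrix o o ℂ)‖ :=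
          Matrix.l2_opNorm_mul _ _
      _ ≤ β' * ((L : ℝ)⁻¹) ^ k * 1 :=
          mul_le_mul (opNorm_siteMul_le _ hβk (hT.consistent k)) (opNorm_kron_le_of_le o (opNorm_JpcT_le L M k)) (norm_nonneg _) hβk
      _ = β' * ((L : ℝ)⁻¹) ^ k := mul_one _

/-- **THE TYPED COVARIANT BLOCK AVERAGING** (model of [B9] (3.19) carried componentwise): transport at the fine sites by `T̂_k`, THEN King's
`k`-fold block mean, on every colour component — `covAvg T̂ k = (Atow Qlev k ⊗ 1)·siteMul T̂_k : (unit sites × components) × colours ←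
(level-k sites × components) × colours`.  At `T̂ = 1` it is `Atow Qlev k ⊗ 1`. [cite: Balaban1985BackgroundPropagators, (3.19) p.393 (shape);
King1986, (2.10) p.653] [folklore] -/
def covAvg (T : (k : ℕ) → idx L M k → Matrix o o ℂ) (k : ℕ) : Matrix (idx L M 0 × o) (idx L M k × o) ℂ :=
  (Atow (Qlev L M) k ⊗ₖ (1 : Matrix o o ℂ)) * siteMul (T k)

/-- at the trivial transport the covariant averaging is the lifted free one. [folklore] -/
theorem covAvg_one (k : ℕ) : covAvg L M o (fun _ _ => (1 : Matrix o o ℂ)) k = Atow (Qlev L M) k ⊗ₖ (1 : Matrix o o ℂ) := by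
  rw [covAvg, siteMul_one, Matrix.mul_one]

/-- **THE COVARIANT-AVERAGING SUMMAND** `P^Q_k = c·((B + E)ᴴ(B + E) − BᴴB)_k` with `B = Btow (Qlev ⊗ 1) L^d`, `E = B·(siteMul T̂ − 1)` — by
`covAvgPert_eq` literally `c·(L^d)^k·(covAvgᴴ·covAvg − (Atow Qlev k ⊗ 1)ᴴ(Atow Qlev k ⊗ 1))`, the model of `a·(Q_k(U)*Q_k(U) − Q_k*Q_k)` in the
normalisation `Q* = n^d·Qᴴ` (`c = a`).  A TYPED OPERATOR; no identification with [B9] (3.23)–(3.26) is asserted (dictionary B0).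
[cite: Balaban1985BackgroundPropagators, (3.26) p.395 (where the summand enters)] [folklore] -/
def covAvgPert (T : (k : ℕ) → idx L M k → Matrix o o ℂ) (c : ℂ) (k : ℕ) : Matrix (idx L M k × o) (idx L M k × o) ℂ :=
  gramPert c (Btow (fun k => Qlev L M k ⊗ₖ (1 : Matrix o o ℂ)) ((L : ℝ) ^ d))
    (Etrans (fun k => Qlev L M k ⊗ₖ (1 : Matrix o o ℂ)) ((L : ℝ) ^ d) (fun k => siteMul (T k))) k

/-- **THE SUMMAND UNFOLDED**: `P^Q_k = c·(L^d)^k·((covAvg T̂ k)ᴴ(covAvg T̂ k) − (Atow Qlev k ⊗ 1)ᴴ(Atow Qlev k ⊗ 1))`. [folklore] -/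
theorem covAvgPert_eq (T : (k : ℕ) → idx L M k → Matrix o o ℂ) (c : ℂ) (k : ℕ) :
    covAvgPert L M o T c k
      = c • ((((L : ℂ) ^ d) ^ k) • ((covAvg L M o T k)ᴴ * covAvg L M o T k
          - (Atow (Qlev L M) k ⊗ₖ (1 : Matrix o o ℂ))ᴴ * (Atow (Qlev L M) k ⊗ₖ (1 : Matrix o o ℂ)))) := by
  rw [covAvgPert, gramPert, gramCore_Btow_Etrans _ (pow_nonneg (Nat.cast_nonneg L) d), Atow_kron, Complex.ofReal_pow,
    Complex.ofReal_natCast]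
  rfl

/-- **`P^Q = 0` AT THE TRIVIAL TRANSPORT, BY CONSTRUCTION** (trigger c5: every statement is about the typed operator, which vanishes at
`U = 1`). [folklore] -/
theorem covAvgPert_one (c : ℂ) (k : ℕ) : covAvgPert L M o (fun _ _ => (1 : Matrix o o ℂ)) c k = 0 := by
  have e : Etrans (fun k => Qlev L M k ⊗ₖ (1 : Matrix o o ℂ)) ((L : ℝ) ^ d)
      (fun j => siteMul (fun _ : idx L M j => (1 : Matrix o o ℂ))) k = 0 := by
    rw [Etrans, siteMul_one, sub_self, Matrix.mul_zero]
  rw [covAvgPert, gramPert, gramCore, e, add_zero, sub_self, smul_zero]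

/-- **THE END THEOREM OF ROW B3.b (instance)**: site transports of size `α′` and block-parent consistency `β′·L^{−k}` give
`PerturbationLaws (k ↦ Δ_a^{(k)} ⊗ₖ 1) (P^Q) (k ↦ J_k ⊗ₖ 1) κ_Q (k ↦ C₂^Q·L^{−k})`, `κ_Q = ‖c‖·α′(2 + α′)·Cst(d,a)`,
`C₂^Q = ‖c‖·C2gram Cst 1 α′ (2dCst) CJ 0 (Cst·β′)` — (H-bd) and (H-cons) for the covariant-averaging summand from the size and the two-level
consistency of the transports ALONE (plus the free tower's defects), with no limit and no rate sum inside.  CONDITIONAL content: the field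
`consistent` is node NE3's statement for Bałaban's backgrounds (row B6), displayed as a binder. [cite: Balaban1985BackgroundPropagators,
(3.19) p.393, (3.26) p.395; King1986, (2.10) p.653, p.664; Balaban1984PropagatorsI, Prop. 1.1 (1.89) p.33] [folklore] -/
theorem perturbationLaws_covariantAveraging {T : (k : ℕ) → idx L M k → Matrix o o ℂ} {α' β' : ℝ}
    (hT : SiteTransportLaws L M o T α' β') (c : ℂ) :
    PerturbationLaws (fun k => calDalev L M a ha k ⊗ₖ (1 : Matrix o o ℂ)) (covAvgPert L M o T c)
      (fun k => JpcT L M k ⊗ₖ (1 : Matrix o o ℂ)) (kappaQ d a c α') (fun k => C2Q d a c α' β' * ((L : ℝ)⁻¹) ^ k) :=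
  perturbationLaws_transportedGram_kron L M a ha o hT.nonneg.1 (transportLaws_siteMul L M o hT) c

/-! ## §4 The η-rate of the covariant-averaging coupling -/

/-- **η-RATE FOR THE COVARIANT-AVERAGING COUPLING** (`L ≥ 2`, every `‖t‖·κ_Q < 1`): the lifted King-averaged unit-lattice covariances of
`(Δ_a^{(k)} ⊗ 1 + t·P^Q_k)⁻¹` CONVERGE with `‖c_k(t) − c_∞(t)‖ ≤ Cpert(t)·L^{−k}/(1 − L^{−1})`,
`Cpert(t) = (CJ + ‖t‖C₂^Q)(1 − ‖t‖κ_Q)^{−2} + 2dCst(1 − ‖t‖κ_Q)^{−1}`; all orders in `t`; statement / pairing / constants OURS.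
[cite: King1986, Lemma 4.5 (4.32)/(4.38) p.674 (scalar resolvent template); Balaban1985BackgroundPropagators, (3.26) p.395] [folklore] -/
theorem towerLimitRate_covariantAveraging (hL : 2 ≤ L) {T : (k : ℕ) → idx L M k → Matrix o o ℂ} {α' β' : ℝ}
    (hT : SiteTransportLaws L M o T α' β') (c : ℂ) {t : ℂ} (ht : ‖t‖ * kappaQ d a c α' < 1) :
    TowerLimitRate (fun k => Qlev L M k ⊗ₖ (1 : Matrix o o ℂ)) ((L : ℝ) ^ d)
      (fun k => (calDalev L M a ha k ⊗ₖ (1 : Matrix o o ℂ) + t • covAvgPert L M o T c k)⁻¹)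
      (Cpert (kappaQ d a c α') (2 * d * Cst d a) (CJ d a) (C2Q d a c α' β') 0 t) ((L : ℝ)⁻¹) :=
  towerLimitRate_transportedGram_kron L M a ha o hL hT.nonneg.1 (transportLaws_siteMul L M o hT) c ht

/-- **THE PHYSICAL VALUE** `c = a`, `t = 1`, in the small-field regime `a·α′(2 + α′)·Cst(d,a) < 1` (threshold DISPLAYED, explicit in
`d, a, α′`): the lifted King-averaged unit-lattice covariances of `(Δ_a^{(k)} ⊗ 1 + P^Q_k)⁻¹` converge with rate `L^{−k}`. [folklore] -/
theorem covariantAveraging_rate (hL : 2 ≤ L) {T : (k : ℕ) → idx L M k → Matrix o o ℂ} {α' β' : ℝ}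
    (hT : SiteTransportLaws L M o T α' β') (hsmall : a * (α' * (2 + α') * Cst d a) < 1) :
    TowerLimitRate (fun k => Qlev L M k ⊗ₖ (1 : Matrix o o ℂ)) ((L : ℝ) ^ d)
      (fun k => (calDalev L M a ha k ⊗ₖ (1 : Matrix o o ℂ) + covAvgPert L M o T (a : ℂ) k)⁻¹)
      (Cpert (kappaQ d a (a : ℂ) α') (2 * d * Cst d a) (CJ d a) (C2Q d a (a : ℂ) α' β') 0 1) ((L : ℝ)⁻¹) := by
  have h1 : ‖(1 : ℂ)‖ * kappaQ d a (a : ℂ) α' < 1 := by rwa [norm_one, one_mul, kappaQ_ofReal ha.le]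
  have h := towerLimitRate_covariantAveraging L M a ha o hL hT (a : ℂ) h1
  simpa only [one_smul] using h

end Tower

end Summit.QuantumFields.BalabanUV.T4Continuum.CovariantAveragingSummand

end
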